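import Mathlib
import Summits.CriticalPhenomena.SAWScalingLimit.Theorems.ObservableToSLE.Negative.CompactContainer
import Summits.CriticalPhenomena.SAWScalingLimit.Theorems.ObservableToSLE.Negative.EndpointNecessity

/-!
# Tightness is NECESSARY for the conclusion of crux `ObservableToSLE` (stmt-CriticalPhenomena-10472)

Negative/structural lemmas (refuter, cdisprove gen 3, obstruction W5).  The crux is
`HexObservableLimit → HexTight → HexConjecture`.  We prove that its second hypothesis is a
CONSEQUENCE of its conclusion:

* `isTightAlongMesh_of_convergesInLawToSLE` — if the critical hexagonal SAW curve classes in
  `(D; a_δ, b_δ)` converge in law to chordal SLE_κ (any `κ`), the family is tight along the mesh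
  (`IsTightAlongMesh`).  This is NOT the soft "convergent ⇒ tight" of sequences: along the
  uncountable filter `𝓝[>] 0` an abstract weakly convergent family need not be eventually tight.
  The proof uses the lattice: Ulam tightness of the SLE law on the Polish space `CurveClass ℂ`,
  one Urysohn test function `min 1 (infDist · K / η)` per scale, the fact that for meshes in a
  compact interval `[lo, hi] ⊆ (0, ∞)` ALL SAW curve classes of the bounded domain lie in one
  compact set (finitely many self-avoiding supports; the rescaled polyline of a fixed support is
  Lipschitz in the mesh, `dist_polyline_map_le`), and a closed totally bounded diagonal
  intersection `⋂ₖ (cthickening (1/(k+1)) Kₖ ∪ Cₖ)`.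
* `convergesInLawToSLE_iff_tight_and_identification` — pointwise: convergence to SLE_κ ⇔
  endpoint approximation ∧ tightness ∧ identification of subsequential limits.
* `hexTight_of_hexConjecture`, `not_hexConjecture_of_not_hexTight` — item `HexTight`
  (stmt-CriticalPhenomena-5423) follows from item `HexConjecture` (stmt-CriticalPhenomena-0808):
  a refutation of eventual tightness refutes DCS Conjecture 1 as typed and every hexagonal route.
* `hexConjecture_iff_tight_and_identification` — `HexConjecture ↔ HexTight ∧ Identification`;
  `observableToSLE_withoutTight_iff` — the crux with `HexTight` discharged is
  `HexObservableLimit → HexTight ∧ Identification`: no line can bypass tightness.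

(Corrects the caveat recorded in cycle 2 that `HexConjecture → HexTight` "is not soft along the
uncountable mesh filter": it is provable, by the lattice finiteness above.)
-/

noncomputable section

open Literature.Probability.RandomPlanarGeometry Literature.Probability.RandomPlanarGeometry.SAW
  Literature.Probability.LatticeModels Literature.Probability MeasureTheory Filter Topology Set
open scoped NNReal ENNReal BoundedContinuousFunction

namespace Summit.CriticalPhenomena.SAWScalingLimit.Theorems.ObservableToSLE.Negative

/-! ### Tightness is necessary -/

/-- Outside the open `η`-thickening of a nonempty set the distance to it is at least `η`. [folklore] -/
theorem le_infDist_of_not_mem_thickening {X : Type*} [PseudoMetricSpace X] {K : Set X}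
    (hK : K.Nonempty) {η : ℝ} {x : X} (hx : x ∈ (Metric.thickening η K)ᶜ) :
    η ≤ Metric.infDist x K := by
  by_contra h
  exact hx ((Metric.mem_thickening_iff_infDist_lt hK).2 (not_le.1 h))

/-- **TIGHTNESS IS NECESSARY.** If the critical hexagonal SAW curve classes in `(D; a_δ, b_δ)`
converge in law (to chordal SLE_κ, any `κ`), then the family is tight along the mesh
(`IsTightAlongMesh`).  Ingredients: Ulam tightness of the limit law on the Polish space
`CurveClass ℂ`; one Urysohn test function per scale `1/(k+1)`; for meshes bounded below, ALL SAW
curve classes lie in one compact set (finitely many supports, continuity in the mesh); a closed,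
totally bounded diagonal intersection.  In particular `HexConjecture → HexTight`: the crux's
hypothesis `HexTight` is a CONSEQUENCE of its conclusion, not a removable technicality. [folklore] -/
theorem isTightAlongMesh_of_convergesInLawToSLE {κ : ℝ≥0} {D : DobrushinDomain}
    {a b : ℝ → HexVertex}
    (h : ConvergesInLawToSLE κ D (fun δ (γ : HexDomainSAW D.carrier δ (a δ) (b δ)) => γ.curve)
      (fun δ => hexSAWLaw D.carrier δ (a δ) (b δ))) :
    IsTightAlongMesh (fun δ (γ : HexDomainSAW D.carrier δ (a δ) (b δ)) => γ.curve)
      (fun δ => hexSAWLaw D.carrier δ (a δ) (b δ)) := by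
  classical
  have hab : IsEmbEndpointApprox hexGraph hexCenter D a b :=
    isEmbEndpointApprox_of_convergesInLawToSLE h
  obtain ⟨Γ, hΓ, -, hT⟩ := h
  haveI := isProbabilityMeasure_preWienerMeasure'
  set μ : Measure (CurveClass ℂ) := Process.preWienerMeasure.map Γ with hμ
  haveI hμP : IsProbabilityMeasure μ := Measure.isProbabilityMeasure_map hΓ.aemeasurable
  -- good meshes: probability laws and distinct endpoints
  have hgood : ∀ᶠ δ in 𝓝[>] (0 : ℝ),
      IsProbabilityMeasure (hexSAWLaw D.carrier δ (a δ) (b δ)) ∧ a δ ≠ b δ := by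
    refine (eventually_isProbabilityMeasure_hexSAWLaw hab).and ?_
    have hne : D.pt 0 ≠ D.pt 1 := fun h => absurd (D.pt_injective h) (by decide)
    obtain ⟨U, V, hU, hV, h0U, h1V, hUV⟩ := t2_separation hne
    filter_upwards [hab.tendsto_fst (hU.mem_nhds h0U), hab.tendsto_snd (hV.mem_nhds h1V)]
      with δ h0 h1 heq
    have h0' : (δ : ℂ) * hexCenter (b δ) ∈ U := by rw [← heq]; exact h0
    exact Set.disjoint_left.1 hUV h0' h1
  intro ε hε
  rcases eq_or_ne ε ⊤ with rfl | hεtop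
  · exact ⟨∅, isCompact_empty, Eventually.of_forall fun δ => le_top⟩
  set e : ℝ := ε.toReal with he
  have he0 : 0 < e := ENNReal.toReal_pos hε.ne' hεtop
  -- per-level data: compact K_k (nonempty), threshold θ_k
  have hlevel : ∀ k : ℕ, ∃ K : Set (CurveClass ℂ), IsCompact K ∧ K.Nonempty ∧ ∃ θ : ℝ, 0 < θ ∧
      ∀ δ ∈ Set.Ioo (0 : ℝ) θ,
        (IsProbabilityMeasure (hexSAWLaw D.carrier δ (a δ) (b δ)) ∧ a δ ≠ b δ) ∧
        hexSAWLaw D.carrier δ (a δ) (b δ)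
            ((fun γ : HexDomainSAW D.carrier δ (a δ) (b δ) => γ.curve) ⁻¹'
              (Metric.thickening (1 / ((k : ℝ) + 1)) K)ᶜ) ≤ ENNReal.ofReal (e / 2 / 2 ^ k) := by
    intro k
    set ek : ℝ := e / 2 / 2 ^ k with hek_def
    have hek : 0 < ek := by positivity
    obtain ⟨K0, hK0c, hK0⟩ := (isTightMeasureSet_iff_exists_isCompact_measure_compl_le.1
      (isTightMeasureSet_singleton (μ := μ))) (ENNReal.ofReal (ek / 2))
      (ENNReal.ofReal_pos.2 (by positivity))
    have hμK0 : μ K0ᶜ ≤ ENNReal.ofReal (ek / 2) := hK0 μ rfl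
    -- make it nonempty
    set c₀ : CurveClass ℂ := CurveClass.mk (Curve.const 0)
    set K1 : Set (CurveClass ℂ) := insert c₀ K0 with hK1
    have hK1c : IsCompact K1 := hK0c.insert c₀
    have hK1ne : K1.Nonempty := ⟨c₀, Set.mem_insert _ _⟩
    have hμK1 : μ K1ᶜ ≤ ENNReal.ofReal (ek / 2) :=
      (measure_mono (Set.compl_subset_compl.2 (Set.subset_insert _ _))).trans hμK0
    have hη : (0 : ℝ) < 1 / ((k : ℝ) + 1) := by positivity
    obtain ⟨g, hg0, hg1, hgK, hgF⟩ := exists_urysohn_infDist K1 hη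
    have hlim : ∫ x, g x ∂μ < ek := by
      refine (integral_urysohn_le hK1c.isClosed hg1 hgK).trans_lt ?_
      rw [measureReal_def]
      have : (μ K1ᶜ).toReal ≤ ek / 2 := ENNReal.toReal_le_of_le_ofReal (by positivity) hμK1
      linarith
    have ht := hT g
    have hint_eq : ∫ ω, g (Γ ω) ∂Process.preWienerMeasure = ∫ x, g x ∂μ :=
      (integral_map hΓ.aemeasurable g.continuous.aestronglyMeasurable).symm
    rw [hint_eq] at ht
    have hev : ∀ᶠ δ in 𝓝[>] (0 : ℝ),
        ∫ γ, g ((fun γ : HexDomainSAW D.carrier δ (a δ) (b δ) => γ.curve) γ)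
          ∂hexSAWLaw D.carrier δ (a δ) (b δ) < ek :=
      ht.eventually (Iio_mem_nhds hlim)
    obtain ⟨θ, hθ, hθsub⟩ := mem_nhdsGT_iff_exists_Ioo_subset.1 (hev.and hgood)
    refine ⟨K1, hK1c, hK1ne, θ, hθ, fun δ hδ => ?_⟩
    obtain ⟨hint, hg'⟩ := hθsub hδ
    refine ⟨hg', ?_⟩
    haveI := hg'.1
    have hF : MeasurableSet (Metric.thickening (1 / ((k : ℝ) + 1)) K1)ᶜ :=
      Metric.isOpen_thickening.measurableSet.compl
    have h1 : (hexSAWLaw D.carrier δ (a δ) (b δ)).real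
        ((fun γ : HexDomainSAW D.carrier δ (a δ) (b δ) => γ.curve) ⁻¹'
          (Metric.thickening (1 / ((k : ℝ) + 1)) K1)ᶜ) ≤
        ∫ γ, g ((fun γ : HexDomainSAW D.carrier δ (a δ) (b δ) => γ.curve) γ)
          ∂hexSAWLaw D.carrier δ (a δ) (b δ) :=
      measureReal_preimage_le_integral (EmbDomainSAW.measurable_of_top _) hF hg0
        fun x hx => hgF x (le_infDist_of_not_mem_thickening hK1ne hx)
    calc hexSAWLaw D.carrier δ (a δ) (b δ)
          ((fun γ : HexDomainSAW D.carrier δ (a δ) (b δ) => γ.curve) ⁻¹'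
            (Metric.thickening (1 / ((k : ℝ) + 1)) K1)ᶜ)
        = ENNReal.ofReal ((hexSAWLaw D.carrier δ (a δ) (b δ)).real
            ((fun γ : HexDomainSAW D.carrier δ (a δ) (b δ) => γ.curve) ⁻¹'
              (Metric.thickening (1 / ((k : ℝ) + 1)) K1)ᶜ)) :=
          (ENNReal.ofReal_toReal (measure_ne_top _ _)).symm
      _ ≤ ENNReal.ofReal ek := ENNReal.ofReal_le_ofReal (h1.trans hint.le)
  choose K hKc hKne θ hθ hKθ using hlevel
  -- antitone positive thresholds `Θ k = min_{j ≤ k} θ j`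
  set Θ : ℕ → ℝ := fun k => (Finset.range (k + 1)).inf' (Finset.nonempty_range_iff.2 (Nat.succ_ne_zero k)) θ
    with hΘ
  have hΘle : ∀ k, Θ k ≤ θ k := fun k =>
    Finset.inf'_le _ (Finset.mem_range.2 (Nat.lt_succ_self k))
  have hΘpos : ∀ k, 0 < Θ k := fun k => (Finset.lt_inf'_iff _).2 fun j _ => hθ j
  have hΘanti : ∀ k, Θ (k + 1) ≤ Θ k := fun k =>
    (Finset.le_inf'_iff _ _).2 fun j hj =>
      Finset.inf'_le _ (Finset.mem_range.2 ((Finset.mem_range.1 hj).trans (Nat.lt_succ_self _)))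
  -- compact containers for meshes in `[Θ (k+1), Θ 0]`
  have hC : ∀ k, ∃ C : Set (CurveClass ℂ), IsCompact C ∧ ∀ δ ∈ Set.Icc (Θ (k + 1)) (Θ 0),
      ∀ u v : HexVertex, u ≠ v → ∀ γ : HexDomainSAW D.carrier δ u v, γ.curve ∈ C := fun k =>
    exists_isCompact_forall_curve_mem D.isBounded (hΘpos (k + 1))
  choose C hCc hCmem using hC
  set η : ℕ → ℝ := fun k => 1 / ((k : ℝ) + 1) with hη
  have hηpos : ∀ k, 0 < η k := fun k => by positivity
  set A : ℕ → Set (CurveClass ℂ) := fun k => Metric.cthickening (η k) (K k) ∪ C k with hA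
  set Kf : Set (CurveClass ℂ) := ⋂ k, A k with hKf
  have hKf_closed : IsClosed Kf :=
    isClosed_iInter fun k => Metric.isClosed_cthickening.union (hCc k).isClosed
  have hKf_tb : TotallyBounded Kf := by
    refine Metric.totallyBounded_iff.2 fun r hr => ?_
    obtain ⟨k, hk⟩ := exists_nat_gt (3 / r)
    have hηk : 3 * η k < r := by
      have h3 : 3 < r * k := by rwa [div_lt_iff₀ hr, mul_comm] at hk
      have hk0 : (0 : ℝ) < k := by
        by_contra h0
        have : (k : ℝ) ≤ 0 := not_lt.1 h0
        nlinarith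
      show 3 * (1 / ((k : ℝ) + 1)) < r
      rw [mul_one_div, div_lt_iff₀ (by positivity)]
      nlinarith
    obtain ⟨t, htfin, htcov⟩ :=
      Metric.totallyBounded_iff.1 ((hKc k).union (hCc k)).totallyBounded (η k) (hηpos k)
    refine ⟨t, htfin, fun x hx => ?_⟩
    have hxA : x ∈ A k := Set.mem_iInter.1 hx k
    rcases hxA with hx1 | hx2
    · have hx1' : x ∈ Metric.thickening (2 * η k) (K k) :=
        Metric.cthickening_subset_thickening' (by linarith [hηpos k]) (by linarith [hηpos k]) _ hx1
      obtain ⟨z, hz, hxz⟩ := Metric.mem_thickening_iff.1 hx1'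
      obtain ⟨y, hy, hzy⟩ := Set.mem_iUnion₂.1 (htcov (Or.inl hz))
      refine Set.mem_iUnion₂.2 ⟨y, hy, ?_⟩
      rw [Metric.mem_ball] at hzy ⊢
      calc dist x y ≤ dist x z + dist z y := dist_triangle _ _ _
        _ < 2 * η k + η k := add_lt_add hxz hzy
        _ = 3 * η k := by ring
        _ < r := hηk
    · obtain ⟨y, hy, hxy⟩ := Set.mem_iUnion₂.1 (htcov (Or.inr hx2))
      refine Set.mem_iUnion₂.2 ⟨y, hy, ?_⟩
      rw [Metric.mem_ball] at hxy ⊢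
      have : η k < r := by linarith [hηpos k]
      exact hxy.trans this
  have hKf_compact : IsCompact Kf :=
    isCompact_iff_totallyBounded_isComplete.2 ⟨hKf_tb, hKf_closed.isComplete⟩
  refine ⟨Kf, hKf_compact, ?_⟩
  filter_upwards [Ioo_mem_nhdsGT (hΘpos 0)] with δ hδ
  have hpre : (fun γ : HexDomainSAW D.carrier δ (a δ) (b δ) => γ.curve) ⁻¹' Kfᶜ =
      ⋃ k, (fun γ : HexDomainSAW D.carrier δ (a δ) (b δ) => γ.curve) ⁻¹' (A k)ᶜ := by
    simp only [hKf, Set.compl_iInter, Set.preimage_iUnion]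
  rw [hpre]
  refine (measure_iUnion_le _).trans ?_
  have hbound : ∀ k, hexSAWLaw D.carrier δ (a δ) (b δ)
      ((fun γ : HexDomainSAW D.carrier δ (a δ) (b δ) => γ.curve) ⁻¹' (A k)ᶜ) ≤
        ENNReal.ofReal (e / 2 / 2 ^ k) := by
    intro k
    rcases lt_or_ge δ (Θ (k + 1)) with hlt | hle
    · have hδk : δ ∈ Set.Ioo 0 (θ k) := ⟨hδ.1, hlt.trans_le ((hΘanti k).trans (hΘle k))⟩
      refine (measure_mono ?_).trans (hKθ k δ hδk).2
      refine Set.preimage_mono (Set.compl_subset_compl.2 ?_)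
      exact (Metric.thickening_subset_cthickening _ _).trans Set.subset_union_left
    · have hne : a δ ≠ b δ := ((hKθ 0 δ ⟨hδ.1, hδ.2.trans_le (hΘle 0)⟩).1).2
      have hempty : (fun γ : HexDomainSAW D.carrier δ (a δ) (b δ) => γ.curve) ⁻¹' (A k)ᶜ = ∅ :=
        Set.eq_empty_of_forall_notMem fun γ hγ => hγ (Or.inr (hCmem k δ ⟨hle, hδ.2.le⟩ _ _ hne γ))
      rw [hempty, measure_empty]
      exact bot_le
  calc ∑' k, hexSAWLaw D.carrier δ (a δ) (b δ)
          ((fun γ : HexDomainSAW D.carrier δ (a δ) (b δ) => γ.curve) ⁻¹' (A k)ᶜ)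
        ≤ ∑' k, ENNReal.ofReal (e / 2 / 2 ^ k) := ENNReal.tsum_le_tsum hbound
    _ = ENNReal.ofReal (∑' k, e / 2 / 2 ^ k) :=
        (ENNReal.ofReal_tsum_of_nonneg (fun k => by positivity) (summable_geometric_two' e)).symm
    _ = ENNReal.ofReal e := by rw [tsum_geometric_two' e]
    _ = ε := ENNReal.ofReal_toReal hεtop

/-! ### Corollaries: the typed DCS Conjecture 1 is exactly tightness plus identification -/

open Summit.CriticalPhenomena.SAWScalingLimit.Theses

/-- Pointwise form: convergence in law of the critical hexagonal SAW to SLE_κ in `(D; a, b)` is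
EQUIVALENT to: endpoint approximation ∧ tightness along the mesh ∧ identification of every
subsequential limit law as an SLE_κ law. [folklore] -/
theorem convergesInLawToSLE_iff_tight_and_identification {κ : ℝ≥0} {D : DobrushinDomain}
    {a b : ℝ → HexVertex} :
    ConvergesInLawToSLE κ D (fun δ (γ : HexDomainSAW D.carrier δ (a δ) (b δ)) => γ.curve)
        (fun δ => hexSAWLaw D.carrier δ (a δ) (b δ)) ↔
      IsEmbEndpointApprox hexGraph hexCenter D a b ∧
      IsTightAlongMesh (fun δ (γ : HexDomainSAW D.carrier δ (a δ) (b δ)) => γ.curve)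
        (fun δ => hexSAWLaw D.carrier δ (a δ) (b δ)) ∧
      ∀ μ : Measure (CurveClass ℂ), IsProbabilityMeasure μ →
        IsSubseqLimitLaw (fun δ (γ : HexDomainSAW D.carrier δ (a δ) (b δ)) => γ.curve)
          (fun δ => hexSAWLaw D.carrier δ (a δ) (b δ)) μ → IsSLELaw κ D μ := by
  constructor
  · intro h
    refine ⟨isEmbEndpointApprox_of_convergesInLawToSLE h,
      isTightAlongMesh_of_convergesInLawToSLE h, fun μ hμ hsub => ?_⟩
    haveI := hμ
    exact isSLELaw_of_isSubseqLimitLaw h hsub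
  · rintro ⟨hab, hT, hid⟩
    exact convergesInLawToSLE_of_identification hab hT hid

/-- `HexConjecture → HexTight`: eventual tightness of the critical hexagonal SAW (item
stmt-CriticalPhenomena-5423) is a CONSEQUENCE of DCS Conjecture 1 as typed (item
stmt-CriticalPhenomena-0808); equivalently `¬ HexTight → ¬ HexConjecture`. [folklore] -/
theorem hexTight_of_hexConjecture (h : SAWDevelopingMap.HexConjecture) : SAWDevelopingMap.HexTight :=
  fun D a b hab => isTightAlongMesh_of_convergesInLawToSLE (h D a b hab)

/-- Contrapositive, for the negatives index: a refutation of `HexTight` refutes `HexConjecture`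
(and with it every hexagonal route). [folklore] -/
theorem not_hexConjecture_of_not_hexTight (h : ¬ SAWDevelopingMap.HexTight) :
    ¬ SAWDevelopingMap.HexConjecture :=
  fun hc => h (hexTight_of_hexConjecture hc)

/-- STRUCTURE OF THE TARGET: DCS Conjecture 1 (typed) ⇔ tightness ∧ identification of
subsequential limits as SLE(8/3) laws. [folklore] -/
theorem hexConjecture_iff_tight_and_identification :
    SAWDevelopingMap.HexConjecture ↔
      SAWDevelopingMap.HexTight ∧
        ∀ (D : DobrushinDomain) (a b : ℝ → HexVertex),
          IsEmbEndpointApprox hexGraph hexCenter D a b →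
            ∀ μ : Measure (CurveClass ℂ), IsProbabilityMeasure μ →
              IsSubseqLimitLaw (fun δ (γ : HexDomainSAW D.carrier δ (a δ) (b δ)) => γ.curve)
                (fun δ => hexSAWLaw D.carrier δ (a δ) (b δ)) μ →
                IsSLELaw ((8 : ℝ≥0) / 3) D μ := by
  constructor
  · intro h
    refine ⟨hexTight_of_hexConjecture h, fun D a b hab μ hμ hsub => ?_⟩
    exact (convergesInLawToSLE_iff_tight_and_identification.1 (h D a b hab)).2.2 μ hμ hsub
  · rintro ⟨hT, hid⟩ D a b hab
    exact convergesInLawToSLE_of_identification hab (hT D a b hab) (hid D a b hab)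

/-- CRUX-LEVEL READING: given `HexObservableLimit`, the crux `ObservableToSLE` with its
hypothesis `HexTight` DISCHARGED (i.e. `HexObservableLimit → HexConjecture`) is equivalent to
`HexObservableLimit → HexTight ∧ Identification`; so any line proving the crux without using
`HexTight` proves `HexTight` on the way. [folklore] -/
theorem observableToSLE_withoutTight_iff :
    (SAWDevelopingMap.HexObservableLimit → SAWDevelopingMap.HexConjecture) ↔
      (SAWDevelopingMap.HexObservableLimit →
        SAWDevelopingMap.HexTight ∧
          ∀ (D : DobrushinDomain) (a b : ℝ → HexVertex),
            IsEmbEndpointApprox hexGraph hexCenter D a b →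
              ∀ μ : Measure (CurveClass ℂ), IsProbabilityMeasure μ →
                IsSubseqLimitLaw (fun δ (γ : HexDomainSAW D.carrier δ (a δ) (b δ)) => γ.curve)
                  (fun δ => hexSAWLaw D.carrier δ (a δ) (b δ)) μ →
                  IsSLELaw ((8 : ℝ≥0) / 3) D μ) := by
  rw [hexConjecture_iff_tight_and_identification]

end Summit.CriticalPhenomena.SAWScalingLimit.Theorems.ObservableToSLE.Negative
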